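import Literature.AlgebraicGeometry.Frobenioids.BirationalizationCor410
import Literature.AlgebraicGeometry.Frobenioids.EquivalencePreStepsQuasiIsotropicFSMFF2024
import HarnessLib

/-!
# Frobenioids I, Corollary 4.10 AS TYPED at THE birationalizations — UNCONDITIONAL over bases of
# FSMFF-type in the author's 2024 reading (Comments (28))

Mochizuki, *The geometry of Frobenioids I: the general theory*, Kyushu J. Math. **62** (2008)
293–400, Cor. 4.10, kurims text pp. 90–91 [cite: MochizukiFrdI2008, Cor. 4.10 p.90]: "Ψ induces a
1-unique functor `Ψ^birat : C₁^birat → C₂^birat` … [by Theorem 3.4, (ii)] …"; Def. 3.1 (i)(d) p. 56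
("`D` is of FSMFF-type") in the revised form of the author's *Comments* (January 2024), item (28)
[cite: MochizukiFrdIComments2024, (28) p.3] (`IsOfFSMFFType2024`).

PROOF-ONLY (seat abc-iut-L1-t10 gen 3; cell GAP-LEDGER row G-L1d8-1, downstream consumer).  The assembly
`PreFrobenioid.cor410_biratData` (`BirationalizationCor410.lean`, same lineage) proves the typed node
statement `PreFrobenioidData.Cor410` at THE birationalizations modulo the single printed input "`Ψ`
[and a quasi-inverse] preserves co-angular pre-steps [cf. Theorem 3.4, (ii)]"; its companion
`cor410_biratData_of_isOfFSMType` discharges that input over bases of FSM-type (seat abc-iut-L1-t13).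
Here the same input is discharged over bases of FSMFF-type in the 2024 reading — a strictly larger class
(`IsOfFSMType.isOfFSMFFType2024`) and the class print actually names in Def. 3.1 (i)(d) — by seat
abc-iut-L1-t11's `FrdI.isCoAngularPreStep_map_of_quasiIsotropic_of_isOfFSMFFType2024`
(`EquivalencePreStepsQuasiIsotropicFSMFF2024.lean`).  As there, the two Frobenioids live in common
universes.  No statement of the paper is restated or strengthened; nothing here bears on [IUTchIII].
-/

namespace Literature.AlgebraicGeometry.Frobenioids

open CategoryTheory

universe w v v' u u'

namespace PreFrobenioid

variable {D₁ : Type u} [Category.{v} D₁] {Φ₁ : D₁ᵒᵖ ⥤ CommMonCat.{w}}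
  {C₁ : Type u'} [Category.{v'} C₁] {F₁ : C₁ ⥤ ElemFrobenioid Φ₁}
  {D₂ : Type u} [Category.{v} D₂] {Φ₂ : D₂ᵒᵖ ⥤ CommMonCat.{w}}
  {C₂ : Type u'} [Category.{v'} C₂] {F₂ : C₂ ⥤ ElemFrobenioid Φ₂}

/-- **[FrdI] Corollary 4.10 AS TYPED — UNCONDITIONAL over bases of FSMFF-type (2024 reading)**: for
Frobenioids `C₁`, `C₂` (of quasi-isotropic type, an antecedent of the typed statement) over bases `D₁`,
`D₂` of FSMFF-type in the sense of Comments (28) and any equivalence `Ψ : C₁ ⥲ C₂`, the typed `Cor410`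
holds at THE birationalizations `biratData hF_i hsq_i`: a `1`-unique `Ψ^birat` making the square
`1`-commute, an equivalence, and rigidity of both composites for slim `D_i` and `C_i` of birationally
Frobenius-normalized type — the Thm. 3.4 (ii) input being seat abc-iut-L1-t11's
`FrdI.isCoAngularPreStep_map_of_quasiIsotropic_of_isOfFSMFFType2024`, applied to `Ψ` and to `Ψ.symm`.
The FSM-type case `cor410_biratData_of_isOfFSMType` is the instance `hD_i.isOfFSMFFType2024`.
[cite: MochizukiFrdI2008, Cor. 4.10 p.90] [cite: MochizukiFrdIComments2024, (28) p.3] -/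
theorem cor410_biratData_of_isOfFSMFFType2024 (hF₁ : IsFrobenioid F₁) (hsq₁ : HasBiratSquares F₁)
    (hF₂ : IsFrobenioid F₂) (hsq₂ : HasBiratSquares F₂) (hD₁ : IsOfFSMFFType2024 D₁)
    (hD₂ : IsOfFSMFFType2024 D₂) (Ψ : C₁ ≌ C₂) :
    PreFrobenioidData.Cor410 (PreFrobenioidData.ofFunctor Φ₁ F₁) (PreFrobenioidData.ofFunctor Φ₂ F₂) Ψ
      (biratData hF₁ hsq₁) (biratData hF₂ hsq₂) := by
  intro hff₁ hff₂ hq₁ hq₂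
  exact cor410_biratData hF₁ hsq₁ hF₂ hsq₂ Ψ
    (fun _ _ _ hf =>
      FrdI.isCoAngularPreStep_map_of_quasiIsotropic_of_isOfFSMFFType2024 hF₁ hF₂ hq₁ hq₂ hD₁ hD₂ Ψ hf)
    (fun _ _ _ hf =>
      FrdI.isCoAngularPreStep_map_of_quasiIsotropic_of_isOfFSMFFType2024 hF₂ hF₁ hq₂ hq₁ hD₂ hD₁ Ψ.symm hf)
    hff₁ hff₂ hq₁ hq₂

end PreFrobenioid

end Literature.AlgebraicGeometry.Frobenioids
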